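import Literature.NumberTheory.Automorphic.ClozelAlgebraicityHeckeFieldResFiniteProofs
import Literature.NumberTheory.Automorphic.ResGLnCuspidalEigenclassOfComparison
import Literature.NumberTheory.Automorphic.CuspidalCohomologyGLRankOneCharacter
import HarnessLib

/-!
# Clozel's Hecke-field theorem from the Eichler–Shimura–Borel COMPARISON and Borel–Serre

Topic `NumberTheory/Automorphic`; proofs-only companion (theorems only: no definition, no named fact,
no instance) of `ClozelAlgebraicityHeckeFieldResFiniteProofs.lean` (which reduces the named fact
`Clozel1990_heckeEigenvalueField` — Clozel 1990, Thm. 3.13 in Hecke-eigenvalue form — to the two named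
facts `ResGLnCohomology.cuspidalEigenclass_exists` for `n ≥ 2` and
`BorelSerre1973_finiteDimensional_groupCohomology_congruenceSubgroup`) and of
`ResGLnCuspidalEigenclassOfComparison.lean` (which reduces `ResGLnCohomology.cuspidalEigenclass_exists`,
all ranks at once, to the COMPARISON for one spherical Hecke eigenform: hypothesis `h` of
`ResGLnCohomology.cuspidalEigenclass_exists_of_eigenformComparison`).

Since the rank-one slice of the cuspidal-eigenclass fact is a theorem
(`ResGLnCohomology.cuspidalEigenclass_exists_rank_one`), the exact residue of a discharge of
`Clozel1990_heckeEigenvalueField` is the comparison for `n ≥ 2` only, plus Borel–Serre.  THIS FILE proves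

* `ResGLnCohomology.cuspidalEigenclass_exists_rank_two_of_eigenformComparison` — the text of
  `cuspidalEigenclass_exists` for `2 ≤ n` from the comparison for `2 ≤ n` (the automorphic half —
  the `T_{v,i}(ϖ_v)` act modulo `W'` by scalars on the `K(𝔫)`-invariants, equal to the
  Satake–Tamagawa values — being the tree theorems
  `AutomorphicRepData.Flath1979_heckeOperator_ofLocal_sub_smul_mem_holds` and
  `AutomorphicRepData.HasSatakeParamAt.eq_esymm_of_sub_smul_mem`) [cite: FlathCorvallis1979, Thm. 3]
  [cite: Clozel1990, Lemme 3.15 and §3.5];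
* `Clozel1990_heckeEigenvalueField_of_eigenformComparison_rank_two_of_borelSerre` and
  `Clozel1990_ratField_numberField_of_eigenformComparison_rank_two_of_borelSerre` — Thm. 3.13 (Hecke
  field, and clause (i)) from {comparison for `n ≥ 2`, Borel–Serre};
* `Clozel1990_heckeEigenvalueField_of_eigenformComparison_of_borelSerre` — the same from the all-rank
  comparison (one line through `cuspidalEigenclass_exists_of_eigenformComparison`).

Not here: the comparison itself (Borel–Wallach VII 2.5–2.7, Borel's regularization Thm. 5.3, Clozel's
Lemme 3.14: `(𝔤, K_∞)`-cohomology of cohomological `π_∞`, the de Rham / van Est comparison with the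
group-cohomology carrier `ResGLnCohomology.levelCohomology`, injectivity of cuspidal cohomology) and
Borel–Serre (FL) — the two apexes, absent from the tree.

## References

* L. Clozel, *Motifs et formes automorphes: applications du principe de fonctorialité*, in:
  Automorphic forms, Shimura varieties, and L-functions I (Ann Arbor 1988), Perspect. Math. 10,
  Academic Press 1990, Thm. 3.13, Lemme 3.14, Lemme 3.15, §3.5 (pp. 120–123). [Clozel1990]
* D. Flath, *Decomposition of representations into tensor products*, Corvallis 1979, Thm. 3.
  [FlathCorvallis1979]
* A. Borel, N. Wallach, *Continuous cohomology, discrete subgroups, and representations of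
  reductive groups*, 2nd ed. (2000), VII 2.5–2.7. [BorelWallach2000]
* A. Borel, *Regularization theorems in Lie algebra cohomology. Applications*, Duke Math. J. 50
  (1983), Thm. 5.3, Cor. 5.5. [Borel1983Regularization]
* A. Borel, J.-P. Serre, *Corners and arithmetic groups*, Comment. Math. Helv. 48 (1973), §11.1 (c),
  Thm. 11.4.4. [BorelSerre1973]
-/

noncomputable section

open scoped Classical
open NumberField IsDedekindDomain

namespace Literature.NumberTheory.Automorphic

open Literature.NumberTheory.DiophantineGeometry Literature.Barriers.Langlands

/-- **`ResGLnCohomology.cuspidalEigenclass_exists` for `n ≥ 2` from the comparison for `n ≥ 2`.**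
Hypothesis `hC` = the hypothesis `h` of `ResGLnCohomology.cuspidalEigenclass_exists_of_eigenformComparison`
restricted to `2 ≤ n`: a `K(𝔫)`-invariant form `φ ∈ W ∖ W'` of a cuspidal `π` of cohomological type
`λ^∨ + ρ` which is an eigenform modulo `W'` of the double cosets `T_{v,i}(ϖ_v)`
(`heckeDiagAt n K v (BigHeckeGLn.uniformizerAt v) i`), `v ∤ 𝔫`, `i ≤ n`, with eigenvalues `c_{v,i}`,
gives a non-zero `x ∈ H^q(S_{K_f(𝔫)}, Ẽ_λ)` (`levelCohomology ℂ n K 𝔫 λ q`) with `T_{v,i} x = c_{v,i} x`.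
Conclusion: the text of the named fact for `2 ≤ n` — the scalars `c_{v,i}` exist for every
`K(𝔫)`-invariant form (`Flath1979_heckeOperator_ofLocal_sub_smul_mem_holds`) and are the
Satake–Tamagawa eigenvalues `q_v^{i(n−i)/2} e_i(α)` of every Satake parameter `α` of `π` at `v`
(`HasSatakeParamAt.eq_esymm_of_sub_smul_mem`).  Same proof as the all-rank
`cuspidalEigenclass_exists_of_eigenformComparison`. [cite: Clozel1990, Lemme 3.15 and §3.5 (pp. 120–123)] -/
theorem ResGLnCohomology.cuspidalEigenclass_exists_rank_two_of_eigenformComparison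
    (hC : ∀ (n : ℕ) (K : Type) [Field K] [NumberField K] (hcpt : isCompact_glFiniteIntegralLevel n K)
      (𝔫 : Ideal (𝓞 K)) (lam : (K →+* ℂ) → Fin n → ℤ), 2 ≤ n → 𝔫 ≠ 0 →
      (∀ τ, Weight.IsDominant (lam τ)) →
      ∀ π : CuspidalAutomorphicRepData n K hcpt,
        (∃ T : InfinityType K n, π.1.HasInfinityType T ∧
          ∀ τ : K →+* ℂ, (T τ).map ArchWeight.a =
            (cohomologicalInfinityType n K (Weight.dual (lam τ)) τ).map ArchWeight.a) →
        ∀ φ ∈ π.1.W, φ ∉ π.1.W' →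
          (∀ u ∈ principalCongruenceLevel n K 𝔫,
            rightTranslation (AdelicGroupData.gl n K) u φ = φ) →
          ∀ c : HeightOneSpectrum (𝓞 K) → ℕ → ℂ,
            (∀ v : HeightOneSpectrum (𝓞 K), ¬ v.asIdeal ∣ 𝔫 → ∀ i ≤ n,
              heckeOperator (rightTranslation (AdelicGroupData.gl n K))
                  (principalCongruenceLevel n K 𝔫)
                  (heckeDiagAt n K v (BigHeckeGLn.uniformizerAt v) i) φ - c v i • φ ∈ π.1.W') →
            ∃ (q : ℕ) (x : ResGLnCohomology.levelCohomology ℂ n K 𝔫 lam q), x ≠ 0 ∧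
              ∀ v : HeightOneSpectrum (𝓞 K), ¬ v.asIdeal ∣ 𝔫 → ∀ i ≤ n,
                ResGLnCohomology.heckeT ℂ n K 𝔫 lam q v i x = c v i • x) :
    ∀ (n : ℕ) (K : Type) [Field K] [NumberField K] (hcpt : isCompact_glFiniteIntegralLevel n K)
      (𝔫 : Ideal (𝓞 K)) (lam : (K →+* ℂ) → Fin n → ℤ), 2 ≤ n → 𝔫 ≠ 0 →
      (∀ τ, Weight.IsDominant (lam τ)) →
      ∀ π : CuspidalAutomorphicRepData n K hcpt,
        (∃ T : InfinityType K n, π.1.HasInfinityType T ∧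
          ∀ τ : K →+* ℂ, (T τ).map ArchWeight.a =
            (cohomologicalInfinityType n K (Weight.dual (lam τ)) τ).map ArchWeight.a) →
        (∃ φ ∈ π.1.W, φ ∉ π.1.W' ∧
          ∀ u ∈ principalCongruenceLevel n K 𝔫, rightTranslation (AdelicGroupData.gl n K) u φ = φ) →
        ∃ (q : ℕ) (x : ResGLnCohomology.levelCohomology ℂ n K 𝔫 lam q), x ≠ 0 ∧
          ∀ v : HeightOneSpectrum (𝓞 K), ¬ v.asIdeal ∣ 𝔫 → ∀ α : Multiset ℂ,
            π.1.HasSatakeParamAt v α → ∀ i ≤ n,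
              ResGLnCohomology.heckeT ℂ n K 𝔫 lam q v i x = heckeEigenvalueOf n v α i • x := by
  intro n K _ _ hcpt 𝔫 lam hn h𝔫 hlam π hT hφ
  obtain ⟨φ, hφW, hφW', hfix⟩ := hφ
  -- the automorphic half: the scalars of `T_{v,i}(ϖ_v)` modulo `W'` on the `K(𝔫)`-invariants
  have hS := π.1.Flath1979_heckeOperator_ofLocal_sub_smul_mem_holds
  choose c hc using fun (v : HeightOneSpectrum (𝓞 K)) (i : ℕ) =>
    hS v (glDiagonal n (v.adicCompletion K) fun k =>
      if (k : ℕ) < i then BigHeckeGLn.uniformizerAt v else 1)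
  have hcφ : ∀ v : HeightOneSpectrum (𝓞 K), ¬ v.asIdeal ∣ 𝔫 → ∀ i ≤ n,
      heckeOperator (rightTranslation (AdelicGroupData.gl n K)) (principalCongruenceLevel n K 𝔫)
          (heckeDiagAt n K v (BigHeckeGLn.uniformizerAt v) i) φ - c v i • φ ∈ π.1.W' := by
    intro v hv i _
    rw [heckeDiagAt_eq_ofLocal_glDiagonal]
    exact hc v i h𝔫 hv φ hφW hfix
  -- the comparison for `φ`
  obtain ⟨q, x, hx, heig⟩ := hC n K hcpt 𝔫 lam hn h𝔫 hlam π hT φ hφW hφW' hfix c hcφ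
  refine ⟨q, x, hx, fun v hv α hα i hi => ?_⟩
  rw [heig v hv i hi, hα.eq_esymm_of_sub_smul_mem hS h𝔫 hv (BigHeckeGLn.valued_uniformizerAt v)
    hφW hφW' hfix hi (hcφ v hv i hi)]
  rfl

/-- **Clozel's Hecke-field theorem (Thm. 3.13, Hecke-eigenvalue form) from the comparison for
`n ≥ 2` and Borel–Serre** — the exact residue of a discharge of `Clozel1990_heckeEigenvalueField`:
`cuspidalEigenclass_exists_rank_two_of_eigenformComparison` fed into
`Clozel1990_heckeEigenvalueField_of_cuspidalEigenclass_rank_two_of_borelSerre` (rank one being the theorem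
`ResGLnCohomology.cuspidalEigenclass_exists_rank_one`, the composition being
`Clozel1990_heckeEigenvalueField_of_resRealisation`). [cite: Clozel1990, Thm. 3.13 (proof, §3.5 pp. 120–123)] -/
theorem Clozel1990_heckeEigenvalueField_of_eigenformComparison_rank_two_of_borelSerre
    (hC : ∀ (n : ℕ) (K : Type) [Field K] [NumberField K] (hcpt : isCompact_glFiniteIntegralLevel n K)
      (𝔫 : Ideal (𝓞 K)) (lam : (K →+* ℂ) → Fin n → ℤ), 2 ≤ n → 𝔫 ≠ 0 →
      (∀ τ, Weight.IsDominant (lam τ)) →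
      ∀ π : CuspidalAutomorphicRepData n K hcpt,
        (∃ T : InfinityType K n, π.1.HasInfinityType T ∧
          ∀ τ : K →+* ℂ, (T τ).map ArchWeight.a =
            (cohomologicalInfinityType n K (Weight.dual (lam τ)) τ).map ArchWeight.a) →
        ∀ φ ∈ π.1.W, φ ∉ π.1.W' →
          (∀ u ∈ principalCongruenceLevel n K 𝔫,
            rightTranslation (AdelicGroupData.gl n K) u φ = φ) →
          ∀ c : HeightOneSpectrum (𝓞 K) → ℕ → ℂ,
            (∀ v : HeightOneSpectrum (𝓞 K), ¬ v.asIdeal ∣ 𝔫 → ∀ i ≤ n,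
              heckeOperator (rightTranslation (AdelicGroupData.gl n K))
                  (principalCongruenceLevel n K 𝔫)
                  (heckeDiagAt n K v (BigHeckeGLn.uniformizerAt v) i) φ - c v i • φ ∈ π.1.W') →
            ∃ (q : ℕ) (x : ResGLnCohomology.levelCohomology ℂ n K 𝔫 lam q), x ≠ 0 ∧
              ∀ v : HeightOneSpectrum (𝓞 K), ¬ v.asIdeal ∣ 𝔫 → ∀ i ≤ n,
                ResGLnCohomology.heckeT ℂ n K 𝔫 lam q v i x = c v i • x)
    (hBS : BorelSerre1973_finiteDimensional_groupCohomology_congruenceSubgroup) :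
    Clozel1990_heckeEigenvalueField :=
  Clozel1990_heckeEigenvalueField_of_cuspidalEigenclass_rank_two_of_borelSerre
    (ResGLnCohomology.cuspidalEigenclass_exists_rank_two_of_eigenformComparison hC) hBS

/-- **Clause (i) of Clozel's Thm. 3.13 (`ℚ(π_f)` is a number field) from the comparison for `n ≥ 2`
and Borel–Serre** (`Clozel1990_heckeEigenvalueField_of_eigenformComparison_rank_two_of_borelSerre`
followed by `Clozel1990_ratField_numberField_of_heckeEigenvalueField`).
[cite: Clozel1990, Thm. 3.13 (i) (proof, §3.5)] -/
theorem Clozel1990_ratField_numberField_of_eigenformComparison_rank_two_of_borelSerre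
    (hC : ∀ (n : ℕ) (K : Type) [Field K] [NumberField K] (hcpt : isCompact_glFiniteIntegralLevel n K)
      (𝔫 : Ideal (𝓞 K)) (lam : (K →+* ℂ) → Fin n → ℤ), 2 ≤ n → 𝔫 ≠ 0 →
      (∀ τ, Weight.IsDominant (lam τ)) →
      ∀ π : CuspidalAutomorphicRepData n K hcpt,
        (∃ T : InfinityType K n, π.1.HasInfinityType T ∧
          ∀ τ : K →+* ℂ, (T τ).map ArchWeight.a =
            (cohomologicalInfinityType n K (Weight.dual (lam τ)) τ).map ArchWeight.a) →
        ∀ φ ∈ π.1.W, φ ∉ π.1.W' →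
          (∀ u ∈ principalCongruenceLevel n K 𝔫,
            rightTranslation (AdelicGroupData.gl n K) u φ = φ) →
          ∀ c : HeightOneSpectrum (𝓞 K) → ℕ → ℂ,
            (∀ v : HeightOneSpectrum (𝓞 K), ¬ v.asIdeal ∣ 𝔫 → ∀ i ≤ n,
              heckeOperator (rightTranslation (AdelicGroupData.gl n K))
                  (principalCongruenceLevel n K 𝔫)
                  (heckeDiagAt n K v (BigHeckeGLn.uniformizerAt v) i) φ - c v i • φ ∈ π.1.W') →
            ∃ (q : ℕ) (x : ResGLnCohomology.levelCohomology ℂ n K 𝔫 lam q), x ≠ 0 ∧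
              ∀ v : HeightOneSpectrum (𝓞 K), ¬ v.asIdeal ∣ 𝔫 → ∀ i ≤ n,
                ResGLnCohomology.heckeT ℂ n K 𝔫 lam q v i x = c v i • x)
    (hBS : BorelSerre1973_finiteDimensional_groupCohomology_congruenceSubgroup) :
    Clozel1990_ratField_numberField :=
  Clozel1990_ratField_numberField_of_heckeEigenvalueField
    (Clozel1990_heckeEigenvalueField_of_eigenformComparison_rank_two_of_borelSerre hC hBS)

/-- **Clozel's Hecke-field theorem from the all-rank comparison and Borel–Serre**: the hypothesis
`h` of `ResGLnCohomology.cuspidalEigenclass_exists_of_eigenformComparison` (all `n ≥ 1`) gives the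
cuspidal-eigenclass fact, and `Clozel1990_heckeEigenvalueField_of_cuspidalEigenclass_of_borelSerre`
concludes. [cite: Clozel1990, Thm. 3.13 (proof, §3.5 pp. 120–123)] -/
theorem Clozel1990_heckeEigenvalueField_of_eigenformComparison_of_borelSerre
    (h : ∀ (n : ℕ) (K : Type) [Field K] [NumberField K] (hcpt : isCompact_glFiniteIntegralLevel n K)
      (𝔫 : Ideal (𝓞 K)) (lam : (K →+* ℂ) → Fin n → ℤ), 1 ≤ n → 𝔫 ≠ 0 →
      (∀ τ, Weight.IsDominant (lam τ)) →
      ∀ π : CuspidalAutomorphicRepData n K hcpt,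
        (∃ T : InfinityType K n, π.1.HasInfinityType T ∧
          ∀ τ : K →+* ℂ, (T τ).map ArchWeight.a =
            (cohomologicalInfinityType n K (Weight.dual (lam τ)) τ).map ArchWeight.a) →
        ∀ φ ∈ π.1.W, φ ∉ π.1.W' →
          (∀ u ∈ principalCongruenceLevel n K 𝔫,
            rightTranslation (AdelicGroupData.gl n K) u φ = φ) →
          ∀ c : HeightOneSpectrum (𝓞 K) → ℕ → ℂ,
            (∀ v : HeightOneSpectrum (𝓞 K), ¬ v.asIdeal ∣ 𝔫 → ∀ i ≤ n,
              heckeOperator (rightTranslation (AdelicGroupData.gl n K))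
                  (principalCongruenceLevel n K 𝔫)
                  (heckeDiagAt n K v (BigHeckeGLn.uniformizerAt v) i) φ - c v i • φ ∈ π.1.W') →
            ∃ (q : ℕ) (x : ResGLnCohomology.levelCohomology ℂ n K 𝔫 lam q), x ≠ 0 ∧
              ∀ v : HeightOneSpectrum (𝓞 K), ¬ v.asIdeal ∣ 𝔫 → ∀ i ≤ n,
                ResGLnCohomology.heckeT ℂ n K 𝔫 lam q v i x = c v i • x)
    (hBS : BorelSerre1973_finiteDimensional_groupCohomology_congruenceSubgroup) :
    Clozel1990_heckeEigenvalueField :=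
  Clozel1990_heckeEigenvalueField_of_cuspidalEigenclass_of_borelSerre
    (ResGLnCohomology.cuspidalEigenclass_exists_of_eigenformComparison h) hBS

end Literature.NumberTheory.Automorphic

end
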